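import Summits.HubbardSuperconductivity.HubbardSuperconductivity.Theses.JosephsonMirror
import Summits.HubbardSuperconductivity.HubbardSuperconductivity.Theorems.JosephsonMirrorPositiveMinimiserCore
import Summits.HubbardSuperconductivity.HubbardSuperconductivity.Theorems.JosephsonMirrorPairBridgeGivesGain

/-!
# Route `JosephsonMirror` — reflection positivity of the Josephson double (`JmPositiveMinimiser`)

Support item stmt-HubbardSuperconductivity-2230 of route `JosephsonMirror` (sub-problem
`HubbardSuperconductivity`): for even `L`, `δ ∈ (0, 1/2)` and `J ≥ 0` the window problem of the
Josephson mirror `H_L(J) = A ⊗ 1 + 1 ⊗ Aᵀ - J (D ⊗ D̄ + Dᴴ ⊗ D̄ᴴ)` (`A = H - μ_L N`,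
`D = L⁻¹ Δ_d`, window `S_L = (N_L, N_L) ⊕ (N_L - 2, N_L - 2)` at `S^z = 0`) has a minimiser
`ψ(s,t) = W_{st}` with `W = Vᴴ V` positive semidefinite, supported on the window, `‖ψ‖ = 1`, of
energy `E_L(J)`. Instance of the abstract reflection-positivity theorem
`exists_posSemidef_window_minimiser` (`Theorems/JosephsonMirrorPositiveMinimiserCore`: Hermitian
ground matrix by the mirror symmetry, then Lieb's `|W|`) with the blocks `(N_L, S^z = 0)` and
`(N_L - 2, S^z = 0)` of the torus (`N_L = 2n`, `1 ≤ n ≤ L²`). NO irreducibility / uniqueness is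
claimed. Sources: E. H. Lieb, Phys. Rev. Lett. 62 (1989) 1201, proof of Theorem 1; F. J. Dyson,
E. H. Lieb, B. Simon, J. Stat. Phys. 18 (1978) 335. No new definitions.
-/

-- the mandated namespace `Summit.<Summit>.<Problem>.Theorems` repeats `HubbardSuperconductivity`
-- (single-problem summit, D-0017), which the `dupNamespace` linter flags on every declaration
set_option linter.dupNamespace false

namespace Summit.HubbardSuperconductivity.HubbardSuperconductivity.Theorems.JosephsonMirror

open Matrix Literature.MathematicalPhysics.QuantumLattice
open Summit.HubbardSuperconductivity.HubbardSuperconductivity.Theses.JosephsonMirror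
open scoped Kronecker ComplexOrder

/-- **`JmPositiveMinimiser`** (stmt-HubbardSuperconductivity-2230): reflection positivity of the
Josephson double in ground-state form — for even `L`, `δ ∈ (0, 1/2)`, `J ≥ 0` the window problem
has a minimiser `ψ(s,t) = W_{st}` with `W = Vᴴ V` (positive semidefinite), supported on the window,
`‖ψ‖ = 1`, energy `E_L(J)`. The antiunitary mirror (layer swap ∘ complex conjugation) commutes
with `H_L(J)` for ANY Hermitian `A` and ANY `D`, so a Hermitian ground matrix exists; Lieb's trace
inequality gives `E(|W|) ≤ E(W)` for `J ≥ 0` with `Tr |W|² = Tr W²`, and `|W|` keeps the block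
support. Lieb, PRL 62 (1989) 1201, proof of Theorem 1; Dyson–Lieb–Simon, J. Stat. Phys. 18
(1978) 335. [folklore] -/
theorem jmPositiveMinimiser_proof :
    Summit.HubbardSuperconductivity.HubbardSuperconductivity.Theses.JosephsonMirror.JmPositiveMinimiser := by
  unfold JmPositiveMinimiser
  intro L _ U δ J hE hδ hJ ι N H μ A D Hd good S E
  -- the filling: `N = 2n` with `1 ≤ n ≤ L²`
  set n : ℕ := ⌊(1 - δ) * (L : ℝ) ^ 2 / 2⌋₊ with hn
  have hNn : N = 2 * n := rfl
  have hL2 : (2 : ℝ) ≤ L := by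
    have h0 : L ≠ 0 := NeZero.ne L
    obtain ⟨k, hk⟩ := hE
    have : 2 ≤ L := by omega
    exact_mod_cast this
  have hn1 : 1 ≤ n := by
    rw [hn]
    refine Nat.le_floor ?_
    rw [Nat.cast_one, le_div_iff₀ (by norm_num : (0 : ℝ) < 2)]
    have hδ2 : 1 / 2 ≤ 1 - δ := by linarith [hδ.2]
    nlinarith [hδ2, hL2]
  have hnL : n ≤ L ^ 2 := by
    rw [hn]
    refine Nat.floor_le_of_le ?_
    have hδ0 : 1 - δ ≤ 1 := by linarith [hδ.1]
    have hL0 : (0 : ℝ) ≤ (L : ℝ) ^ 2 := by positivity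
    push_cast
    nlinarith
  have hAherm : A.IsHermitian := isHermitian_hamiltonianWith _ 1 U μ
  -- block predicates
  set F : ι → Prop := fun s =>
    (s.filter fun o => (ofLex o).2 = 0).card = (s.filter fun o => (ofLex o).2 = 1).card with hF
  set P₁ : ι → Prop := fun s => s.card = N ∧ F s with hP₁
  set P₂ : ι → Prop := fun s => s.card = N - 2 ∧ F s with hP₂
  have h12 : ∀ s, P₁ s → ¬ P₂ s := by
    rintro s ⟨h1, -⟩ ⟨h2, -⟩
    omega
  have hgood : ∀ s t, good (s, t) → (P₁ s ∧ P₁ t) ∨ (P₂ s ∧ P₂ t) := by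
    rintro s t ⟨h | h, hs, ht⟩
    · exact Or.inl ⟨⟨h.1, hs⟩, ⟨h.2, ht⟩⟩
    · exact Or.inr ⟨⟨h.1, hs⟩, ⟨h.2, ht⟩⟩
  have hgood₁ : ∀ s t, P₁ s → P₁ t → good (s, t) := fun s t hs ht =>
    ⟨Or.inl ⟨hs.1, ht.1⟩, hs.2, ht.2⟩
  have hgood₂ : ∀ s t, P₂ s → P₂ t → good (s, t) := fun s t hs ht =>
    ⟨Or.inr ⟨hs.1, ht.1⟩, hs.2, ht.2⟩
  have hS : ∀ ψ, ψ ∈ S ↔ ∀ p, ¬ good p → ψ p = 0 := by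
    intro ψ
    simp only [S, Submodule.mem_iInf, LinearMap.mem_ker, LinearMap.proj_apply]
  -- the block `(N_L, S^z = 0)` is nonempty: `n` up and `n` down electrons on the same `n` sites
  have hne : ∃ s : ι, P₁ s := by
    obtain ⟨α, -, hα⟩ : ∃ α : Finset (FermionTorus 2 L), α ⊆ Finset.univ ∧ α.card = n :=
      Finset.exists_subset_card_eq (by rw [Finset.card_univ, card_fermionTorus]; exact hnL)
    refine ⟨pairSet α α, ?_⟩
    have h := (block_iff n (pairSet α α)).2
      ⟨by rw [upPart_pairSet, hα], by rw [downPart_pairSet, hα]⟩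
    simpa [hP₁, hF, hNn] using h
  obtain ⟨W, V, h1, h2, h3, h4⟩ := exists_posSemidef_window_minimiser A D hAherm P₁ P₂ h12 good
    hgood hgood₁ hgood₂ hne S hS hJ
  exact ⟨W, V, h1, h2, h3, h4⟩

end Summit.HubbardSuperconductivity.HubbardSuperconductivity.Theorems.JosephsonMirror
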